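import Mathlib
import Literature.NumberTheory.LFunctions.Zhang2022.SkeletonPartOne
import HarnessLib

/-!
# Zhang (2022) §4, typed statements B: the `𝒜` paragraph — `𝒜` analytic with the zeros of
# `L(s,ψ)L(s,ψχ)`, `F⁻¹ ≪ 𝓛⁷⁹`, and the deduction of (4.10) (tex L1129–L1143, PDF p. 21;
# DAG nodes Z22:§4.u038–u040 and Z22:(4.10), layer L1 row t6 as re-scoped 2026-08-25T23:27:59Z)

Topic `Literature/NumberTheory/LFunctions/Zhang2022` (Landau–Siegel adjudication tree;
verdict-neutral). Y. Zhang, *Discrete mean estimates and the Landau–Siegel zero*,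
arXiv:2211.02515v1 (2022) [Zhang2022LandauSiegel] — **an unrefereed manuscript under
adjudication: every `def … : Prop` below is a CLAIM OF THE MANUSCRIPT, STATED NOT ASSERTED**, one
declaration per DAG node, over the banked skeleton objects (`Skeleton.{calA, LL, Fpoly, Omega1,
PsiOne, ell, ForAllLarge, Lemma41, Lemma42, Lemma44, Eq410}`). Throughout §4 the manuscript
assumes `ψ ∈ Ψ₁` (tex L886); it is an explicit binder here.

Scope. The proof of Lemma 4.4 ((4.7)–(4.9), tex L1040–L1127) is typed in the sibling file
`Section4Statements.lean` (namespace `…Zhang2022.Section4`, nodes Z22:§4.u023–u037, (4.7)–(4.9),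
Z22:Lem4.4.pf: `ResidueSplit`, `LineOneEval`, `GSumBound`, `FELine`, `ThreeWaySplit`, `Eq47`–`Eq49`,
`Shift47/48/49`, `Ded44`, …) — cited, not restated. CITED skeleton nodes: Z22:(4.10) =
`Skeleton.Eq410`, Z22:§4.u038 (the display `𝒜 = L·L/F`) = `Skeleton.calA`, Z22:§4.u040
(`ℬ = Z̃F(1−s,ψ̄)/F`) = `Skeleton.calB`.

| node | decl | locator |
|---|---|---|
| Z22:§4.u038 (the sentence after the display) | `Step4u038` | p.21 tex L1133 |
| Z22:§4.u039 | `Step4u039` | p.21 tex L1135 |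
| Z22:(4.10), its printed deduction | `Ded410` (the display itself = `Skeleton.Eq410`) | p.21 tex L1138 |

Kernel-checked here: `step4u039_of : Skeleton.Lemma41 → Skeleton.Lemma42 → Step4u039` (the printed
«by Lemma 4.1 and 4.2» for `F⁻¹ ≪ 𝓛⁷⁹`), with the eventual-inequality helper `forAllLarge_le_ell`.

## References

* Y. Zhang, arXiv:2211.02515v1 (2022), §4 p. 21 (tex L1129–L1143).
  [cite: Zhang2022LandauSiegel, §4 p.21]
-/

noncomputable section

open Complex Real
open Literature.NumberTheory.LFunctions.Zhang2022
open Literature.NumberTheory.LFunctions.Zhang2022.Skeleton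

namespace Literature.NumberTheory.LFunctions.Zhang2022.Section4

/-- Z22:§4.u038 [Z22 p.21, tex L1133] «By Lemma 4.2, `𝒜(s,ψ)` is analytic and it has the same zeros
as `L(s,ψ)L(s,ψχ)` in `Ω₁`» (`𝒜(s,ψ) = L(s,ψ)L(s,χψ)/F(s,ψ)` = `Skeleton.calA`, cited; "the same
zeros" typed as the same zero set in `Ω₁`; `ψ ∈ Ψ₁`). CLAIM. [cite: Zhang2022LandauSiegel, §4 p.21] -/
def Step4u038 : Prop :=
  ForAllLarge fun D _ χ => ∀ x ∈ PsiOne χ,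
    AnalyticOnNhd ℂ (calA χ x) (Omega1 D) ∧ ∀ s ∈ Omega1 D, (calA χ x s = 0 ↔ LL χ x s = 0)

/-- Z22:§4.u039 [Z22 p.21, tex L1135] «Further, for `s ∈ Ω₁`, we have `F(s,ψ)⁻¹ ≪ 𝓛⁷⁹` by
Lemma 4.1 and 4.2» (`ψ ∈ Ψ₁`). CLAIM. [cite: Zhang2022LandauSiegel, §4 p.21] -/
def Step4u039 : Prop :=
  ∃ C : ℝ, ForAllLarge fun D _ χ => ∀ x ∈ PsiOne χ, ∀ s ∈ Omega1 D,
    ‖(Fpoly χ x s)⁻¹‖ ≤ C * ell D ^ 79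

/-- Z22:(4.10), the printed deduction [Z22 p.21, tex L1138] «This [`F⁻¹ ≪ 𝓛⁷⁹` by Lemma 4.1 and
4.2] together with Lemma 4.4 implies that `𝒜(s,ψ) = 1 + ℬ(s,ψ) + O(𝓛⁻¹⁰⁰)` (4.10) for `s ∈ Ω₃`»
((4.10) itself = `Skeleton.Eq410`, cited). CLAIM (edge not kernel-checked here).
[cite: Zhang2022LandauSiegel, §4 (4.10) p.21] -/
def Ded410 : Prop :=
  Skeleton.Lemma41 → Skeleton.Lemma42 → Skeleton.Lemma44 → Step4u039 → Skeleton.Eq410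

/-! ## Kernel-checked edge: Z22:§4.u039 from Lemmas 4.1 and 4.2 -/

/-- `𝓛 ≥ K` eventually, for any fixed real `K` (`𝓛 = log D`). [cite: Zhang2022LandauSiegel, §2 (2.1)] -/
private theorem forAllLarge_le_ell (K : ℝ) : ForAllLarge fun D _ _ => K ≤ ell D := by
  refine ⟨⌈Real.exp K⌉₊, fun D _ χ hD _ _ => ?_⟩
  have hD' : Real.exp K ≤ D := le_trans (Nat.le_ceil _) (by exact_mod_cast hD)
  exact (Real.le_log_iff_exp_le (lt_of_lt_of_le (Real.exp_pos K) hD')).mpr hD'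

/-- **Z22:§4.u039 ⇐ Lemmas 4.1, 4.2** [Z22 p.21, tex L1135] «for `s ∈ Ω₁`, we have `F(s,ψ)⁻¹ ≪ 𝓛⁷⁹`
by Lemma 4.1 and 4.2»: kernel-checked EDGE — from `|F| + |G| ≤ C₁𝓛⁷⁹` and `|FG − 1| ≤ C₂𝓛⁻²²⁷`,
once `C₂𝓛⁻²²⁷ ≤ 1/2` we get `|FG| ≥ 1/2`, so `|F⁻¹| = |G|/|FG| ≤ 2C₁𝓛⁷⁹`.
[cite: Zhang2022LandauSiegel, §4 p.21] -/
theorem step4u039_of (h41 : Skeleton.Lemma41) (h42 : Skeleton.Lemma42) : Step4u039 := by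
  obtain ⟨C₁, h1⟩ := h41
  obtain ⟨C₂, h2⟩ := h42
  refine ⟨2 * C₁, ((h1.and h2).and (forAllLarge_le_ell (max 1 (2 * C₂)))).mono ?_⟩
  intro D _ χ _ _ h x hx s hs
  obtain ⟨⟨hFG, hFG1⟩, hK⟩ := h
  have hF := hFG x hx s hs
  have hP := hFG1 x hx s hs
  have hℓ1 : 1 ≤ ell D := le_trans (le_max_left _ _) hK
  have hℓ0 : 0 < ell D := lt_of_lt_of_le one_pos hℓ1
  have hC₂ : 2 * C₂ ≤ ell D := le_trans (le_max_right _ _) hK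
  -- `C₂ 𝓛⁻²²⁷ ≤ 1/2`
  have hpow : ell D ≤ ell D ^ 227 := by
    calc ell D = ell D ^ 1 := (pow_one _).symm
      _ ≤ ell D ^ 227 := pow_le_pow_right₀ hℓ1 (by norm_num)
  have hsmall : C₂ * (ell D ^ 227)⁻¹ ≤ 1 / 2 := by
    have h227 : 0 < ell D ^ 227 := pow_pos hℓ0 _
    rw [← div_eq_mul_inv, div_le_iff₀ h227]
    linarith
  -- `|FG| ≥ 1/2`, hence `F ≠ 0`
  set F := Fpoly χ x s with hFdef
  set G := Gpoly χ x s with hGdef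
  have hFG_lb : 1 / 2 ≤ ‖F * G‖ := by
    have : ‖(1 : ℂ)‖ - ‖F * G - 1‖ ≤ ‖F * G‖ := by
      have := norm_sub_norm_le (1 : ℂ) (F * G)
      rw [show (1 : ℂ) - F * G = -(F * G - 1) by ring, norm_neg] at this
      linarith
    rw [norm_one] at this
    linarith
  have hFG_ne : F * G ≠ 0 := by
    intro h0; rw [h0, norm_zero] at hFG_lb; linarith
  have hF_ne : F ≠ 0 := left_ne_zero_of_mul hFG_ne
  have hG_ne : G ≠ 0 := right_ne_zero_of_mul hFG_ne
  -- `F⁻¹ = G / (FG)`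
  have hinv : F⁻¹ = G / (F * G) := by
    field_simp
  have hG : ‖G‖ ≤ C₁ * ell D ^ 79 := le_trans (le_add_of_nonneg_left (norm_nonneg F)) hF
  calc ‖F⁻¹‖ = ‖G‖ / ‖F * G‖ := by rw [hinv, norm_div]
    _ ≤ ‖G‖ / (1 / 2) := by
        apply div_le_div_of_nonneg_left (norm_nonneg _) (by norm_num) hFG_lb
    _ = 2 * ‖G‖ := by ring
    _ ≤ 2 * (C₁ * ell D ^ 79) := by linarith
    _ = 2 * C₁ * ell D ^ 79 := by ring

end Literature.NumberTheory.LFunctions.Zhang2022.Section4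

end
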